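import Literature.Computability.QuantumComplexity.QFTQubits
import HarnessLib

/-!
# Segment layouts: consecutive registers on a line of wires

Topic `Literature/Computability/QuantumComplexity`; support for the discharge of
`VanDamSeroussi2002_gaussSumPhase_qsolvable` (the register layout of one copy of the gadget-free
van Dam–Seroussi circuit: two dozen registers and one constant header segment per oracle gate, all
consecutive). A list of segment lengths `segs`; segment `j` occupies the wires
`[pre j, pre j + segs[j])` of `Fin segs.sum`:

* `SegLayout.pre segs j` (prefix sums; `pre_succ`, `pre_mono`, `pre_add_le_pre`, `pre_add_le_sum`);
* `SegLayout.emb segs j : Fin (segs.getD j 0) ↪ Fin segs.sum`, `emb_val` (the wire NUMBER `pre j + i`,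
  which the circuit generator computes) and **`emb_ne`** (distinct segments are disjoint) — the two
  facts every register-level side condition of the copy reduces to.

Everything is proved; no named fact.

## References

* M. A. Nielsen, I. L. Chuang, CUP 2010, §4.1 (registers of a circuit as consecutive wires) [NielsenChuang2010].
-/

namespace Literature.Computability.QuantumComplexity

namespace SegLayout

variable (segs : List ℕ)

/-- The first wire of segment `j`: the total length of the segments before it. [folklore] -/
def pre (j : ℕ) : ℕ := (segs.take j).sum

/-- No segment before the first. [folklore] -/
@[simp] theorem pre_zero : pre segs 0 = 0 := by simp [pre]

/-- The next segment starts after this one. [folklore] -/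
theorem pre_succ (j : ℕ) : pre segs (j + 1) = pre segs j + segs.getD j 0 := by
  rw [pre, pre, List.take_add_one, List.sum_append]
  congr 1
  rw [List.getD_eq_getElem?_getD]
  cases segs[j]? <;> simp

/-- Beyond the list every segment is empty and `pre` is the total. [folklore] -/
theorem pre_of_length_le {j : ℕ} (h : segs.length ≤ j) : pre segs j = segs.sum := by
  rw [pre, List.take_of_length_le h]

/-- `pre` is monotone. [folklore] -/
theorem pre_mono {j j' : ℕ} (h : j ≤ j') : pre segs j ≤ pre segs j' := by
  induction h with
  | refl => exact le_rfl
  | step _ ih => exact ih.trans (by rw [pre_succ]; exact Nat.le_add_right _ _)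

/-- A segment ends before any later one starts. [folklore] -/
theorem pre_add_le_pre {j j' : ℕ} (h : j < j') : pre segs j + segs.getD j 0 ≤ pre segs j' := by
  rw [← pre_succ]; exact pre_mono segs h

/-- Every segment ends within the line. [folklore] -/
theorem pre_add_le_sum (j : ℕ) : pre segs j + segs.getD j 0 ≤ segs.sum := by
  rw [← pre_succ, ← pre_of_length_le segs (le_max_left segs.length (j + 1))]
  exact pre_mono segs (le_max_right _ _)

/-- **Wire `i` of segment `j`.** [cite: NielsenChuang2010, §4.1] -/
def emb (j : ℕ) : Fin (segs.getD j 0) ↪ Fin segs.sum :=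
  ⟨fun i => ⟨pre segs j + i, lt_of_lt_of_le (Nat.add_lt_add_left i.isLt _) (pre_add_le_sum segs j)⟩,
    fun i i' h => Fin.ext (by have := congrArg Fin.val h; simp only at this; omega)⟩

/-- The wire number of wire `i` of segment `j` is `pre j + i`. [folklore] -/
@[simp] theorem emb_val (j : ℕ) (i : Fin (segs.getD j 0)) : (emb segs j i : ℕ) = pre segs j + i := rfl

/-- **Distinct segments are disjoint.** [folklore] -/
theorem emb_ne {j j' : ℕ} (h : j ≠ j') (i : Fin (segs.getD j 0)) (i' : Fin (segs.getD j' 0)) : emb segs j i ≠ emb segs j' i' := by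
  intro heq
  have hv : pre segs j + i = pre segs j' + i' := by have := congrArg Fin.val heq; simpa using this
  rcases lt_or_gt_of_ne h with hlt | hlt
  · have := pre_add_le_pre segs hlt
    have hi := i.isLt
    omega
  · have := pre_add_le_pre segs hlt
    have hi' := i'.isLt
    omega

/-- Wires of one segment are distinct iff their indices are. [folklore] -/
theorem emb_eq_emb_iff (j : ℕ) (i i' : Fin (segs.getD j 0)) : emb segs j i = emb segs j i' ↔ i = i' :=
  (emb segs j).injective.eq_iff

/-- A wire of segment `j` is not in the range of another segment's embedding. [folklore] -/
theorem emb_not_mem_range {j j' : ℕ} (h : j ≠ j') (i : Fin (segs.getD j 0)) : emb segs j i ∉ Set.range (emb segs j') := by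
  rintro ⟨i', hi'⟩
  exact emb_ne segs h i i' hi'.symm

/-- The wire number determines the segment: a wire of segment `j` lies in `[pre j, pre j + segs[j])`. [folklore] -/
theorem pre_le_emb_val (j : ℕ) (i : Fin (segs.getD j 0)) : pre segs j ≤ (emb segs j i : ℕ) ∧ (emb segs j i : ℕ) < pre segs j + segs.getD j 0 :=
  ⟨Nat.le_add_right _ _, Nat.add_lt_add_left i.isLt _⟩

end SegLayout

end Literature.Computability.QuantumComplexity
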